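import Summits.Ventures.LatticeQCDFlow.Exactness.FlowSamplerSquareIntegrableMonotone
import Summits.Ventures.LatticeQCDFlow.Exactness.Phi4HMCPolyObsFloor
import HarnessLib

/-!
# Row 2's FLOW ARM on polynomial observables of lattice φ⁴: the magnetisation ITSELF decorrelates monotonically and inherits the sticking and tunnelling floors

HONEST FRAMING: exact (Metropolis-corrected) sampling algorithms for lattice gauge theory;
figures of merit are autocorrelation/cost numbers at stated couplings and volumes; no
continuum-physics claim.  (SCALAR calibration rung S0-A: not a gauge result.)

Venture `LatticeQCDFlow` (cell pub-lqcd), topic `Exactness`; FANOUT row 2 (`s0-phi4`, FLOW arm of the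
S0-A calibration: real-NVP proposals `q̃` + independence-Metropolis accept/reject against `e^{−S}`,
`K = imhOpPhi4 J λ q̃`; every `λ > 0`, every real coupling matrix `J`, EVERY positive measurable
model density with `∫ q̃ = 1` — however badly trained).  NEW WORK of the cell: the lattice instances
of `FlowSamplerSquareIntegrable{,Contraction,Positive,Monotone}` — the tree's class `PolyObs`
(`|f| ≤ B (1 + Σ φ_w²)^k`: the magnetisation `M = Σ_x φ_x`, `M²`, the action, every polynomial) is
square-integrable against `e^{−S}` (`Phi4HMCPolyObs.polyObs_integrable_mul_mul_gibbsWeight`), so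
every flow-arm floor of the tree, so far typed for BOUNDED observables only (gens 10–19), now holds
for `M` itself.  Nothing is cited as a fact.

## What is proved (`Λ = Fin (n+1)`, `λ > 0`, `C_g(k) = ∫ g (Kᵏ g) e^{−S}`, `ρ = C/C(0)`,
`r(φ) = ∫ (1 − α(φ,φ')) q̃(φ') dφ'` the rejection probability of the flow proposal from `φ`)

* `polyObs_sq_integrable` — `PolyObs ⊆ {measurable, ∫ f² e^{−S} < ∞}`;
* **`phi4Flow_autocov_shape_poly`** — for every `g ∈ PolyObs` and every lag:
  `0 ≤ C(k+1) ≤ C(k)`, convex, log-convex (the magnetisation never anti-correlates under the flow arm);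
* **`phi4Flow_tauInt_ge_half_add_rejection_poly`** — summable series ⇒
  `τ_int(g) ≥ ½ + ρ_g(1) ≥ ½ + ⟨g² r⟩/⟨g²⟩`: THE STICKING FLOOR for every polynomial observable
  (with `g = M − ⟨M⟩`: `τ_int(M) ≥ ½ + ⟨(M − ⟨M⟩)² r⟩/Var M` — configurations the flow under-covers
  are held, and the magnetisation pays for it);
* **`phi4Flow_tauInt_ge_geom_poly`** — summable ⇒ `ρ(1) < 1` and `τ_int ≥ (1 + ρ(1))/(2(1 − ρ(1)))`;
* **`phi4Flow_tauInt_ge_stickingOdds_poly`** — summable ⇒ `r̄ < 1` and `τ_int ≥ ½ + r̄/(1 − r̄)`,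
  `r̄ = ⟨g² r⟩/⟨g²⟩`;
* **`phi4Flow_tauInt_ge_cross_poly`** — the cross-observable floor `τ_int(g) ≥ ⟨gθ⟩²/(⟨g²⟩ · 2r_θ) − ½`
  for every `g ∈ PolyObs` and every phase label `θ = ±1` of a measurable `F` at level `c`
  (`r_θ = Z⁻¹ ∫∫ min(e^{−S(φ)} q̃(φ'), e^{−S(φ')} q̃(φ)) χ_flip` = equilibrium probability per proposal
  of an ACCEPTED label change);
* **`phi4Flow_tauInt_ge_magnetisation_signFlip`** — THE MAGNETISATION INHERITS THE TUNNELLING FLOOR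
  under the flow arm: `τ_int(M) ≥ ⟨|M|⟩² / (Var(M) · 2 r_sign) − ½` (all three S0-A arms now:
  `Phi4MetropolisMagnetisationTunnelling`, `Phi4HMCMagnetisationTunnelling`, this file).

NOT CLAIMED: summability / `ρ(1) < 1` / any value of `r`, `r_sign`, `⟨|M|⟩`, `Var M` for any run or
trained network; non-polynomial unbounded observables beyond `L²(e^{−S})`; any rate.
-/

namespace Summit.Ventures.LatticeQCDFlow.Exactness

open Real MeasureTheory Filter Finset Set
open Summit.Ventures.LatticeQCDFlow.Scoring

section Lattice

variable {n : ℕ}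

/-- **`PolyObs` observables are square-integrable against `e^{−S}`** (`λ > 0`, any real `J`). -/
theorem polyObs_sq_integrable {lam : ℝ} (hlam : 0 < lam) (J : Fin (n + 1) → Fin (n + 1) → ℝ)
    {f : (Fin (n + 1) → ℝ) → ℝ} (hf : PolyObs f) :
    Measurable f ∧ Integrable (fun φ => f φ ^ 2 * gibbsWeight J lam φ) := by
  refine ⟨hf.1, ?_⟩
  have h := polyObs_integrable_mul_mul_gibbsWeight one_pos (latticePhi4Action_coercive hlam J) hf hf
  exact h.congr (Eventually.of_forall fun φ => by simp only [sq])

/-- **THE FLOW ARM DECORRELATES EVERY POLYNOMIAL OBSERVABLE MONOTONICALLY, CONVEXLY, LOG-CONVEXLY**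
(the magnetisation, `M²`, the action, …; every `λ > 0`, real `J`, positive model density `q̃`). -/
theorem phi4Flow_autocov_shape_poly {lam : ℝ} (hlam : 0 < lam) (J : Fin (n + 1) → Fin (n + 1) → ℝ)
    {q : (Fin (n + 1) → ℝ) → ℝ} (hq0 : ∀ φ, 0 < q φ) (hqm : Measurable q) (hqi : Integrable q)
    (hq1 : ∫ φ, q φ = 1) {g : (Fin (n + 1) → ℝ) → ℝ} (hg : PolyObs g) (k : ℕ) :
    0 ≤ ∫ φ, g φ * ((imhOpPhi4 J lam q)^[k + 1] g) φ * gibbsWeight J lam φ ∧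
    ∫ φ, g φ * ((imhOpPhi4 J lam q)^[k + 1] g) φ * gibbsWeight J lam φ
      ≤ ∫ φ, g φ * ((imhOpPhi4 J lam q)^[k] g) φ * gibbsWeight J lam φ ∧
    (∫ φ, g φ * ((imhOpPhi4 J lam q)^[k + 1] g) φ * gibbsWeight J lam φ)
        - ∫ φ, g φ * ((imhOpPhi4 J lam q)^[k + 2] g) φ * gibbsWeight J lam φ
      ≤ (∫ φ, g φ * ((imhOpPhi4 J lam q)^[k] g) φ * gibbsWeight J lam φ)
        - ∫ φ, g φ * ((imhOpPhi4 J lam q)^[k + 1] g) φ * gibbsWeight J lam φ ∧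
    (∫ φ, g φ * ((imhOpPhi4 J lam q)^[k + 1] g) φ * gibbsWeight J lam φ) ^ 2
      ≤ (∫ φ, g φ * ((imhOpPhi4 J lam q)^[k] g) φ * gibbsWeight J lam φ)
        * ∫ φ, g φ * ((imhOpPhi4 J lam q)^[k + 2] g) φ * gibbsWeight J lam φ := by
  obtain ⟨hgm, hg2⟩ := polyObs_sq_integrable hlam J hg
  rw [imhOpPhi4_eq_imhOp]
  exact imhOp_autocov_shape_of_sq (μ := volume) (fun φ => gibbsWeight_pos J lam φ)
    (continuous_gibbsWeight J lam).measurable (integrable_gibbsWeight hlam J) hq0 hqm hqi hq1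
    hgm hg2 k

/-- Bookkeeping: `⟨g² r⟩/⟨g²⟩ = (∫ g² e^{−S} r)/(∫ g² e^{−S})` (`Z` cancels; `α` of the lattice operator is
the general `imhAcceptQ` of `e^{−S}`). -/
theorem gibbsExpect_sq_mul_rejection_div {lam : ℝ} (hlam : 0 < lam)
    (J : Fin (n + 1) → Fin (n + 1) → ℝ) (q : (Fin (n + 1) → ℝ) → ℝ) (g : (Fin (n + 1) → ℝ) → ℝ) :
    gibbsExpect J lam (fun φ => g φ ^ 2 * ∫ φ', (1 - imhAcceptPhi4 J lam q φ φ') * q φ')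
        / gibbsExpect J lam (fun φ => g φ ^ 2)
      = (∫ φ, g φ ^ 2 * gibbsWeight J lam φ
          * ∫ φ', (1 - imhAcceptQ (gibbsWeight J lam) q φ φ') * q φ')
        / ∫ φ, g φ ^ 2 * gibbsWeight J lam φ := by
  have hZ := gibbsZ_pos hlam J
  unfold gibbsExpect
  rw [div_div_div_cancel_right₀ hZ.ne']
  congr 1
  refine integral_congr_ae (Eventually.of_forall fun φ => ?_)
  show (g φ ^ 2 * ∫ φ', (1 - imhAcceptPhi4 J lam q φ φ') * q φ') * gibbsWeight J lam φ = _
  have hα : ∀ φ', imhAcceptPhi4 J lam q φ φ' = imhAcceptQ (gibbsWeight J lam) q φ φ' := fun _ => rfl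
  simp_rw [hα]
  ring

/-- **THE STICKING FLOOR FOR EVERY POLYNOMIAL OBSERVABLE OF THE FLOW ARM**: if the autocorrelation
series of `g ∈ PolyObs` is summable then `½ + ⟨g² r⟩/⟨g²⟩ ≤ ½ + ρ_g(1) ≤ τ_int(g)`, `r(φ)` the
rejection probability of the flow proposal from `φ`.  With `g = M − ⟨M⟩`:
`τ_int(M) ≥ ½ + ⟨(M − ⟨M⟩)² r⟩ / Var M`. -/
theorem phi4Flow_tauInt_ge_half_add_rejection_poly {lam : ℝ} (hlam : 0 < lam)
    (J : Fin (n + 1) → Fin (n + 1) → ℝ) {q : (Fin (n + 1) → ℝ) → ℝ} (hq0 : ∀ φ, 0 < q φ)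
    (hqm : Measurable q) (hqi : Integrable q) (hq1 : ∫ φ, q φ = 1)
    {g : (Fin (n + 1) → ℝ) → ℝ} (hg : PolyObs g)
    (hs : Summable fun k => (∫ φ, g φ * ((imhOpPhi4 J lam q)^[k + 1] g) φ * gibbsWeight J lam φ)
      / ∫ φ, g φ ^ 2 * gibbsWeight J lam φ) :
    1 / 2 + gibbsExpect J lam (fun φ => g φ ^ 2 * ∫ φ', (1 - imhAcceptPhi4 J lam q φ φ') * q φ')
        / gibbsExpect J lam (fun φ => g φ ^ 2)
      ≤ 1 / 2 + (∫ φ, g φ * imhOpPhi4 J lam q g φ * gibbsWeight J lam φ)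
        / ∫ φ, g φ ^ 2 * gibbsWeight J lam φ ∧
    1 / 2 + (∫ φ, g φ * imhOpPhi4 J lam q g φ * gibbsWeight J lam φ)
        / ∫ φ, g φ ^ 2 * gibbsWeight J lam φ
      ≤ tauInt (fun k => (∫ φ, g φ * ((imhOpPhi4 J lam q)^[k] g) φ * gibbsWeight J lam φ)
        / ∫ φ, g φ ^ 2 * gibbsWeight J lam φ) := by
  obtain ⟨hgm, hg2⟩ := polyObs_sq_integrable hlam J hg
  rw [gibbsExpect_sq_mul_rejection_div hlam J q g, imhOpPhi4_eq_imhOp]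
  rw [imhOpPhi4_eq_imhOp] at hs
  exact imhOp_tauInt_ge_half_add_rejection_of_sq (μ := volume) (fun φ => gibbsWeight_pos J lam φ)
    (continuous_gibbsWeight J lam).measurable (integrable_gibbsWeight hlam J) hq0 hqm hqi hq1
    hgm hg2 hs

/-- **THE GEOMETRIC (MADRAS–SLADE) FLOOR FOR EVERY POLYNOMIAL OBSERVABLE OF THE FLOW ARM**: a summable
series forces `ρ(1) < 1`, and `τ_int ≥ (1 + ρ(1))/(2(1 − ρ(1)))`. -/
theorem phi4Flow_tauInt_ge_geom_poly {lam : ℝ} (hlam : 0 < lam) (J : Fin (n + 1) → Fin (n + 1) → ℝ)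
    {q : (Fin (n + 1) → ℝ) → ℝ} (hq0 : ∀ φ, 0 < q φ) (hqm : Measurable q) (hqi : Integrable q)
    (hq1 : ∫ φ, q φ = 1) {g : (Fin (n + 1) → ℝ) → ℝ} (hg : PolyObs g)
    (hs : Summable fun k => (∫ φ, g φ * ((imhOpPhi4 J lam q)^[k + 1] g) φ * gibbsWeight J lam φ)
      / ∫ φ, g φ ^ 2 * gibbsWeight J lam φ) :
    (∫ φ, g φ * imhOpPhi4 J lam q g φ * gibbsWeight J lam φ) / (∫ φ, g φ ^ 2 * gibbsWeight J lam φ)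
        < 1 ∧
    (1 + (∫ φ, g φ * imhOpPhi4 J lam q g φ * gibbsWeight J lam φ) / ∫ φ, g φ ^ 2 * gibbsWeight J lam φ)
        / (2 * (1 - (∫ φ, g φ * imhOpPhi4 J lam q g φ * gibbsWeight J lam φ)
          / ∫ φ, g φ ^ 2 * gibbsWeight J lam φ))
      ≤ tauInt (fun k => (∫ φ, g φ * ((imhOpPhi4 J lam q)^[k] g) φ * gibbsWeight J lam φ)
        / ∫ φ, g φ ^ 2 * gibbsWeight J lam φ) := by
  obtain ⟨hgm, hg2⟩ := polyObs_sq_integrable hlam J hg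
  rw [imhOpPhi4_eq_imhOp] at hs ⊢
  exact imhOp_tauInt_ge_geom_of_sq (μ := volume) (fun φ => gibbsWeight_pos J lam φ)
    (continuous_gibbsWeight J lam).measurable (integrable_gibbsWeight hlam J) hq0 hqm hqi hq1
    hgm hg2 hs

/-- **THE STICKING-ODDS FLOOR FOR EVERY POLYNOMIAL OBSERVABLE OF THE FLOW ARM**: with
`r̄ = ⟨g² r⟩/⟨g²⟩` the `g²`-weighted mean rejection probability of the flow proposal, a summable
series forces `r̄ < 1` and `τ_int(g) ≥ (1 + r̄)/(2(1 − r̄)) = ½ + r̄/(1 − r̄)` (for `g = M − ⟨M⟩`: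
`τ_int(M) ≥ ½ + r̄_M/(1 − r̄_M)`, `r̄_M = ⟨(M−⟨M⟩)² r⟩/Var M`). -/
theorem phi4Flow_tauInt_ge_stickingOdds_poly {lam : ℝ} (hlam : 0 < lam)
    (J : Fin (n + 1) → Fin (n + 1) → ℝ) {q : (Fin (n + 1) → ℝ) → ℝ} (hq0 : ∀ φ, 0 < q φ)
    (hqm : Measurable q) (hqi : Integrable q) (hq1 : ∫ φ, q φ = 1)
    {g : (Fin (n + 1) → ℝ) → ℝ} (hg : PolyObs g)
    (hs : Summable fun k => (∫ φ, g φ * ((imhOpPhi4 J lam q)^[k + 1] g) φ * gibbsWeight J lam φ)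
      / ∫ φ, g φ ^ 2 * gibbsWeight J lam φ) :
    gibbsExpect J lam (fun φ => g φ ^ 2 * ∫ φ', (1 - imhAcceptPhi4 J lam q φ φ') * q φ')
        / gibbsExpect J lam (fun φ => g φ ^ 2) < 1 ∧
    (1 + gibbsExpect J lam (fun φ => g φ ^ 2 * ∫ φ', (1 - imhAcceptPhi4 J lam q φ φ') * q φ')
          / gibbsExpect J lam (fun φ => g φ ^ 2))
        / (2 * (1 - gibbsExpect J lam (fun φ => g φ ^ 2 * ∫ φ', (1 - imhAcceptPhi4 J lam q φ φ') * q φ')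
          / gibbsExpect J lam (fun φ => g φ ^ 2)))
      ≤ tauInt (fun k => (∫ φ, g φ * ((imhOpPhi4 J lam q)^[k] g) φ * gibbsWeight J lam φ)
        / ∫ φ, g φ ^ 2 * gibbsWeight J lam φ) := by
  obtain ⟨hgm, hg2⟩ := polyObs_sq_integrable hlam J hg
  rw [gibbsExpect_sq_mul_rejection_div hlam J q g, imhOpPhi4_eq_imhOp]
  rw [imhOpPhi4_eq_imhOp] at hs
  exact imhOp_tauInt_ge_stickingOdds_of_sq (μ := volume) (fun φ => gibbsWeight_pos J lam φ)
    (continuous_gibbsWeight J lam).measurable (integrable_gibbsWeight hlam J) hq0 hqm hqi hq1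
    hgm hg2 hs

/-- **THE CROSS-OBSERVABLE FLOOR OF THE FLOW ARM FOR EVERY POLYNOMIAL OBSERVABLE.**  `g ∈ PolyObs`,
`θ = ±1` the label of a measurable `F` at level `c`,
`r_θ = Z⁻¹ ∫∫ min(e^{−S(φ)} q̃(φ'), e^{−S(φ')} q̃(φ)) χ_flip(φ, φ')` the equilibrium probability per
proposal of an accepted label change.  If the autocorrelation series of `g` is summable, then
`τ_int(g) ≥ ⟨g θ⟩² / (⟨g²⟩ · 2 r_θ) − ½`. -/
theorem phi4Flow_tauInt_ge_cross_poly {lam : ℝ} (hlam : 0 < lam) (J : Fin (n + 1) → Fin (n + 1) → ℝ)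
    {q : (Fin (n + 1) → ℝ) → ℝ} (hq0 : ∀ φ, 0 < q φ) (hqm : Measurable q) (hqi : Integrable q)
    (hq1 : ∫ φ, q φ = 1) {g : (Fin (n + 1) → ℝ) → ℝ} (hg : PolyObs g)
    {F : (Fin (n + 1) → ℝ) → ℝ} (hF : Measurable F) (c : ℝ)
    (hs : Summable fun k => (∫ φ, g φ * ((imhOpPhi4 J lam q)^[k + 1] g) φ * gibbsWeight J lam φ)
        / ∫ φ, g φ ^ 2 * gibbsWeight J lam φ) :
    gibbsExpect J lam (fun φ => g φ * (if c ≤ F φ then (1 : ℝ) else -1)) ^ 2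
        / (gibbsExpect J lam (fun φ => g φ ^ 2)
          * (2 * ((∫ p, imhFlow (gibbsWeight J lam) q p.1 p.2
            * (if (c ≤ F p.1 ↔ c ≤ F p.2) then (0 : ℝ) else 1)
              ∂((volume : Measure (Fin (n + 1) → ℝ)).prod volume)) / gibbsZ J lam))) - 1 / 2
      ≤ tauInt (fun k => (∫ φ, g φ * ((imhOpPhi4 J lam q)^[k] g) φ * gibbsWeight J lam φ)
        / ∫ φ, g φ ^ 2 * gibbsWeight J lam φ) := by
  have hZ := gibbsZ_pos hlam J
  obtain ⟨hgm, hg2⟩ := polyObs_sq_integrable hlam J hg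
  rw [imhOpPhi4_eq_imhOp] at hs ⊢
  have h := imhOp_tauInt_ge_cross_of_sq (μ := volume) (fun φ => gibbsWeight_pos J lam φ)
    (continuous_gibbsWeight J lam).measurable (integrable_gibbsWeight hlam J) hq0 hqm hqi hq1
    hgm hg2 hF c hs
  unfold gibbsExpect
  have e : ∀ B P R : ℝ, (B / gibbsZ J lam) ^ 2 / (P / gibbsZ J lam * (2 * (R / gibbsZ J lam)))
      = B ^ 2 / (P * (2 * R)) := fun B P R => cross_floor_transfer hZ.ne' B P R 2
  rw [e]
  exact h

/-- **THE MAGNETISATION INHERITS THE TUNNELLING (SIGN-FLIP) FLOOR UNDER THE FLOW ARM.**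
`g = M − ⟨M⟩`, `θ = sgn M`; if the autocorrelation series of `M` under `imhOpPhi4 J λ q̃` is summable:
`τ_int(M) ≥ ⟨|M|⟩² / (Var(M) · 2 r_sign) − ½`, `r_sign` the equilibrium probability per flow
proposal of an ACCEPTED change of the sign of `M` (in the two-peak regime `⟨|M|⟩² ≈ Var M`, so
`τ_int(M) ≳ 1/(2 r_sign)`: a flow that rarely tunnels has a slow magnetisation, quantitatively). -/
theorem phi4Flow_tauInt_ge_magnetisation_signFlip {lam : ℝ} (hlam : 0 < lam)
    (J : Fin (n + 1) → Fin (n + 1) → ℝ) {q : (Fin (n + 1) → ℝ) → ℝ} (hq0 : ∀ φ, 0 < q φ)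
    (hqm : Measurable q) (hqi : Integrable q) (hq1 : ∫ φ, q φ = 1)
    (hs : Summable fun k => (∫ φ, ((∑ x, φ x) - gibbsExpect J lam (fun ψ => ∑ x, ψ x))
        * ((imhOpPhi4 J lam q)^[k + 1]
            (fun ψ => (∑ x, ψ x) - gibbsExpect J lam (fun ψ => ∑ x, ψ x))) φ * gibbsWeight J lam φ)
        / ∫ φ, ((∑ x, φ x) - gibbsExpect J lam (fun ψ => ∑ x, ψ x)) ^ 2 * gibbsWeight J lam φ) :
    gibbsExpect J lam (fun φ => |∑ x, φ x|) ^ 2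
        / (gibbsExpect J lam (fun φ => ((∑ x, φ x) - gibbsExpect J lam (fun ψ => ∑ x, ψ x)) ^ 2)
          * (2 * ((∫ p, imhFlow (gibbsWeight J lam) q p.1 p.2
            * (if (0 ≤ ∑ x, p.1 x ↔ 0 ≤ ∑ x, p.2 x) then (0 : ℝ) else 1)
              ∂((volume : Measure (Fin (n + 1) → ℝ)).prod volume)) / gibbsZ J lam))) - 1 / 2
      ≤ tauInt (fun k => (∫ φ, ((∑ x, φ x) - gibbsExpect J lam (fun ψ => ∑ x, ψ x))
        * ((imhOpPhi4 J lam q)^[k]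
            (fun ψ => (∑ x, ψ x) - gibbsExpect J lam (fun ψ => ∑ x, ψ x))) φ * gibbsWeight J lam φ)
        / ∫ φ, ((∑ x, φ x) - gibbsExpect J lam (fun ψ => ∑ x, ψ x)) ^ 2 * gibbsWeight J lam φ) := by
  have hMm : Measurable fun φ : Fin (n + 1) → ℝ => ∑ y, φ y :=
    Finset.measurable_sum _ fun y _ => measurable_pi_apply y
  set mM := gibbsExpect J lam (fun ψ : Fin (n + 1) → ℝ => ∑ x, ψ x) with hmM
  have h := phi4Flow_tauInt_ge_cross_poly hlam J hq0 hqm hqi hq1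
    (polyObs_sub_const polyObs_magnetisation mM) hMm 0 hs
  rw [gibbsExpect_magnetisation_sub_mul_sign hlam J mM] at h
  exact h

end Lattice

end Summit.Ventures.LatticeQCDFlow.Exactness
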